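import Summits.Parity.GeneralizedHardyLittlewood.Theorems.LeeYangFibresPrimeCellsRelativeChowlaDefs
import Summits.Parity.GeneralizedHardyLittlewood.Theorems.LeeYangFibresAbsoluteUpgradeClipCellsScale
import Summits.Parity.GeneralizedHardyLittlewood.Theorems.LeeYangFibresAbsoluteUpgradeSinglesDecayThresholds
import Summits.Parity.GeneralizedHardyLittlewood.Theorems.LeeYangFibresAbsoluteUpgradeRoughAnatomy
import Summits.Parity.GeneralizedHardyLittlewood.Theorems.LeeYangFibresCellParityLawSingularRatio
import Summits.Parity.GeneralizedHardyLittlewood.Theorems.LeeYangFibresPrimeCellsRelativeChowlaClipsParityArith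
import Literature.NumberTheory.Sieve.LinearEquationsInPrimesSubsystems
import HarnessLib

/-!
# Route `LeeYangFibres`, crux `PrimeCellsRelative` (stmt-Parity-14112), line `SketchIdeator4`
# (card `sieve-out-to-chowla`): the registered stub `stub_chowlaClipsParity` — the constant schedule

The composition of the line: from the sieve transfer (`SieveTransfer`), the Walsh extraction
(`WalshExtraction`), the singleton class sums (`SingletonClassSums`, Bombieri–Vinogradov for `λ`),
the weighted tuple class sums (`WeightedTupleClassSums t`, `t ≥ 2`, the Cauchy–Schwarz form of the
line's conjectural input `LiouvilleTupleMean`), the rough anatomy (`RoughAnatomy`), the parity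
balance of the route's `ModelCellFacts` and the route's crux `CellParityLaw`, the prime corner cell
`C_𝟙` of every admissible `(Ψ, K)` is its model `M a₁^t` (`M = β_∞ ∏_p β_p`, `a₁ = A_1(N)/N`) up
to `ε (M a₁^t + N/log^t N)`: the route's node `PrimeCellsRelative`.

Quantifier plumbing over the vocabulary; the real-variable budget is the helper file
`Theorems/LeeYangFibresPrimeCellsRelativeChowlaClipsParityArith.lean` (`perSet_bound`: for one
`S ≠ ∅`, `|θ_S| M a₁^t ≤ (δ + 2^{t+1} ε_M) M a₁^t + J + (2/c)^t E` from the Walsh extraction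
`|θ_S| M Â^t ≤ |E_S| + 2^{t+1}|Ã| Â^{t-1} M + u^t E`, the sieve transfer + class sums
`|E_S| ≤ C e^{-s} M (u/ℓ)^t + J`, `C e^{-s} ≤ δ c^t`, `Â ≥ c u/ℓ`, `a₁ ≤ min(Â, 2/ℓ)`, `|Ã| ≤ ε_M Â`;
`final_budget`: `E + 2^t(…) ≤ ε (M a₁^t + N/ℓ^t)` for `δ = ε/2^{t+2}`, `ε_M = δ/2^{t+1}`,
`ε_law = ε/(2^{t+2}((2/c)^t + 1))`, `J ≤ δ N/ℓ^t`).  Here: small lemmas on the vocabulary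
(monotonicity of the root-class sums in the level, the Walsh form and the model cell at the prime
corner, the sum over the `2^t − 1` non-empty `S`, the `t = 1`-vacuous weighted class sums) and
`stub_chowlaClipsParity`: constants in the order
`ε → δ → ε_M → (u₀, c, C, C₁, C₂, η) → s → u → ε_law → N₀`, then the per-scale argument
(anatomy `a₁ ≤ 2/ℓ`, `Â ≥ c u/ℓ`; balance `|Ã| ≤ ε_M Â`; the law's `θ`; Walsh extraction; per
`S ≠ ∅` the sieve transfer at `σ = σ_S` and the singleton (`S = {i}`, level `N^{1/8} ≥ N^{2s/u}`) or
weighted (`|S| ≥ 2`, level `N^η ≥ N^{2s/u}`) class sums; `perSet_bound`; sum; `final_budget`).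

References: Green–Tao 2010 §1 [GreenTao2010] (normalisations `β_∞`, `∏_p β_p`, the error shape of
Conj. 1.4); Friedlander–Iwaniec, Opera de Cribro, Cor. 6.10 [FriedlanderIwaniecOpera2010] (the
`e^{-s}` of the sieve transfer, killed by the choice of `s`).
-/

noncomputable section

open scoped BigOperators Classical
open Finset Filter

namespace Summit.Parity.GeneralizedHardyLittlewood.Cruxes.PrimeCellsRelative.SieveOutToChowla

open Literature.NumberTheory.Sieve
open Summit.Parity.GeneralizedHardyLittlewood.Theses.LeeYangFibres
open Summit.Parity.GeneralizedHardyLittlewood.Cruxes.AbsoluteUpgrade.NlcCellsAbsoluteClip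
  (roughTuples jointCell walshForm modelCell roughCell RoughAnatomy)
open Summit.Parity.GeneralizedHardyLittlewood.Theorems.AbsoluteUpgrade
open Summit.Parity.GeneralizedHardyLittlewood.Cruxes.CellParityLaw.SectionAnnihilator.SingularRatio
  (singularProduct_nonneg)

/-! ## Small lemmas on the vocabulary -/

/-- The root-class sums are monotone in the level (a non-negative double sum over the squarefree
`d ≤ D`). [folklore] -/
theorem rootClassSums_mono {t : ℕ} (Ψ : Fin t → AffLinForm 1) (S : Finset (Fin t)) (m₁ m₂ : ℤ)
    {D D' : ℕ} (h : D ≤ D') : rootClassSums Ψ S m₁ m₂ D ≤ rootClassSums Ψ S m₁ m₂ D' := by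
  unfold rootClassSums
  refine Finset.sum_le_sum_of_subset_of_nonneg
    (Finset.filter_subset_filter _ (Finset.Icc_subset_Icc_right h)) fun d _ _ => ?_
  exact Finset.sum_nonneg fun _ _ => abs_nonneg _

/-- Levels are monotone in the exponent: `⌊N^a⌋ ≤ ⌊N^b⌋` for `a ≤ b`, `N ≥ 1`. [folklore] -/
theorem level_mono {N : ℕ} (hN : 1 ≤ N) {a b : ℝ} (h : a ≤ b) :
    ⌊(N : ℝ) ^ a⌋₊ ≤ ⌊(N : ℝ) ^ b⌋₊ :=
  Nat.floor_le_floor (Real.rpow_le_rpow_of_exponent_le (by exact_mod_cast hN) h)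

/-- The Walsh form at the prime corner is `Σ_S θ_S`. [folklore] -/
theorem walshForm_one_eq {t : ℕ} (θ : Finset (Fin t) → ℝ) :
    walshForm θ (fun _ => 1) = ∑ S, θ S := by
  unfold walshForm
  refine Finset.sum_congr rfl fun S _ => ?_
  rw [Finset.prod_eq_one fun i _ => by norm_num, mul_one]

/-- `|Θ_θ(𝟙) − 1| ≤ Σ_{S ≠ ∅} |θ_S|` when `θ_∅ = 1`. [folklore] -/
theorem abs_walshForm_one_sub_one_le {t : ℕ} (θ : Finset (Fin t) → ℝ) (h0 : θ ∅ = 1) :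
    |walshForm θ (fun _ => 1) - 1| ≤ ∑ S ∈ Finset.univ.erase ∅, |θ S| := by
  rw [walshForm_one_eq, ← Finset.add_sum_erase Finset.univ θ (Finset.mem_univ ∅), h0,
    add_sub_cancel_left]
  exact Finset.abs_sum_le_sum_abs _ _

/-- The model cell at the prime corner: `M_𝟙 = β_∞ ∏β_p · (A_1/N)^t`. [folklore] -/
theorem modelCell_one {t : ℕ} (Ψ : Fin t → AffLinForm 1) (K : Set (Fin 1 → ℝ)) (N u : ℕ) :
    modelCell Ψ K N u (fun _ => 1) =
      archFactor Ψ K * singularProduct Ψ * ((roughCell N u 1 : ℝ) / N) ^ t := by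
  rw [modelCell, Finset.prod_const, Finset.card_univ, Fintype.card_fin]

/-- Summing per-set bounds over the `2^t − 1 ≤ 2^t` non-empty `S`. [folklore] -/
theorem sum_erase_mul_le {t : ℕ} (θ : Finset (Fin t) → ℝ) {Q B : ℝ} (hB : 0 ≤ B)
    (h : ∀ S ∈ (Finset.univ : Finset (Finset (Fin t))).erase ∅, |θ S| * Q ≤ B) :
    (∑ S ∈ Finset.univ.erase ∅, |θ S|) * Q ≤ 2 ^ t * B := by
  rw [Finset.sum_mul]
  calc ∑ S ∈ Finset.univ.erase ∅, |θ S| * Q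
      ≤ ((Finset.univ : Finset (Finset (Fin t))).erase ∅).card • B := Finset.sum_le_card_nsmul _ _ _ h
    _ = (((Finset.univ : Finset (Finset (Fin t))).erase ∅).card : ℝ) * B := nsmul_eq_mul _ _
    _ ≤ 2 ^ t * B := by
        refine mul_le_mul_of_nonneg_right ?_ hB
        calc (((Finset.univ : Finset (Finset (Fin t))).erase ∅).card : ℝ)
            ≤ ((Finset.univ : Finset (Finset (Fin t))).card : ℝ) := by
              exact_mod_cast Finset.card_erase_le
          _ = 2 ^ t := by
              rw [Finset.card_univ, Fintype.card_finset, Fintype.card_fin]; push_cast; ring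

/-- Step A: from the law at the prime corner and the amplitudes to the cell,
`|C_𝟙 − Q| ≤ E + (Σ_{S ≠ ∅} |θ_S|) Q` (`Q = M a₁^t ≥ 0`). [folklore] -/
theorem corner_cell_le {t : ℕ} (θ : Finset (Fin t) → ℝ) (hθ0 : θ ∅ = 1) {C Q E : ℝ}
    (hQ : 0 ≤ Q) (hlaw : |C - walshForm θ (fun _ => 1) * Q| ≤ E) :
    |C - Q| ≤ E + (∑ S ∈ Finset.univ.erase ∅, |θ S|) * Q :=
  (abs_sub_model_le C _ Q hQ).trans
    (add_le_add hlaw (mul_le_mul_of_nonneg_right (abs_walshForm_one_sub_one_le θ hθ0) hQ))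

/-- The weighted class sums uniformly in `t` (vacuous for `t ≤ 1`: no `S ⊆ Fin t` has two
elements) and with a non-negative constant. [folklore] -/
theorem weighted_uniform {t : ℕ} (hWT : ∀ t : ℕ, 2 ≤ t → WeightedTupleClassSums t) (L : ℕ) :
    ∃ η : ℝ, 0 < η ∧ ∃ C : ℝ, 0 ≤ C ∧ ∃ N₀ : ℕ, ∀ N : ℕ, N₀ ≤ N →
      ∀ Ψ : Fin t → AffLinForm 1, IsNondegenerateSystem Ψ → affLinSize Ψ N ≤ L →
      ∀ m₁ m₂ : ℤ, Finset.Icc m₁ m₂ ⊆ Finset.Icc (-(N : ℤ)) N →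
      ∀ S : Finset (Fin t), 2 ≤ S.card →
        rootClassSums Ψ S m₁ m₂ ⌊(N : ℝ) ^ η⌋₊ ≤ C * N / Real.log N ^ (t + 1) := by
  rcases Nat.lt_or_ge t 2 with ht | ht
  · refine ⟨1, one_pos, 0, le_rfl, 0, fun N _ Ψ _ _ m₁ m₂ _ S hS => ?_⟩
    have : S.card ≤ t := (Finset.card_le_univ S).trans (by rw [Fintype.card_fin])
    omega
  · obtain ⟨η, hη, C, N₀, h⟩ := hWT t ht L
    refine ⟨η, hη, max C 0, le_max_right _ _, N₀, fun N hN Ψ hΨ hL m₁ m₂ hI S hS => ?_⟩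
    refine (h N hN Ψ hΨ hL m₁ m₂ hI S hS).trans ?_
    have h0 : 0 ≤ (N : ℝ) / Real.log N ^ (t + 1) :=
      div_nonneg (Nat.cast_nonneg N) (pow_nonneg (Real.log_natCast_nonneg N) _)
    calc C * N / Real.log N ^ (t + 1) = C * (N / Real.log N ^ (t + 1)) := by ring
      _ ≤ max C 0 * (N / Real.log N ^ (t + 1)) := mul_le_mul_of_nonneg_right (le_max_left _ _) h0
      _ = max C 0 * N / Real.log N ^ (t + 1) := by ring

/-! ## The composition -/

/-- **`stub_chowlaClipsParity` — the constant schedule of the line `SketchIdeator4`.**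
Given the sieve transfer, the Walsh extraction, the singleton and weighted class-sum bounds, the
rough anatomy, the parity balance of `ModelCellFacts` and the route's `CellParityLaw`, the prime
corner cell is its model up to `ε (M a₁^t + N/log^t N)`: `PrimeCellsRelative`.  Constants in the
order `ε → δ → ε_M → u₀, c, C, C₁, C₂, η → s → u → ε_law → N₀`; per scale, Walsh extraction bounds
every `|θ_S| M Â^t` by `|E_S| + 2^{t+1}|Ã|Â^{t-1}M + u^t E`, the sieve transfer and the class sums
bound `|E_S|`, `perSet_bound` converts to `|θ_S| M a₁^t`, and `|C_𝟙 − M a₁^t| ≤ E + Σ_{S≠∅}|θ_S| M a₁^t`. -/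
theorem stub_chowlaClipsParity :
    SieveTransfer → WalshExtraction → SingletonClassSums → (∀ t : ℕ, 2 ≤ t → WeightedTupleClassSums t) →
      RoughAnatomy → ModelCellFacts → CellParityLaw → PrimeCellsRelative := by
  intro hST hWE hSC hWT hRA hMC hCPL t L ht ε hε
  -- the constants `δ, ε_M`
  obtain ⟨δ, hδ⟩ : ∃ δ : ℝ, δ = ε / 2 ^ (t + 2) := ⟨_, rfl⟩
  have hδ0 : 0 < δ := by rw [hδ]; positivity
  obtain ⟨εM, hεM⟩ : ∃ εM : ℝ, εM = δ / 2 ^ (t + 1) := ⟨_, rfl⟩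
  have hεM0 : 0 < εM := by rw [hεM]; positivity
  -- `u₀` (parity balance), `c` (anatomy), `C` (sieve), `C₁, C₂, η` (class sums)
  obtain ⟨u₀, hu₀⟩ := hMC εM hεM0
  obtain ⟨c, hc, Nra, hra⟩ := hRA 1
  obtain ⟨C, hC0, hst⟩ := hST t L
  obtain ⟨C₁, hC₁, Ns, hsc⟩ := hSC t L
  obtain ⟨η, hη, C₂, hC₂, Nw, hw⟩ := weighted_uniform (t := t) hWT L
  -- `s` with `C e^{-s} ≤ δ c^t`
  obtain ⟨s, hs⟩ : ∃ s : ℝ, s = max 1 (Real.log ((C + 1) / (δ * c ^ t))) := ⟨_, rfl⟩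
  have hs1 : 1 ≤ s := (le_max_left _ _).trans_eq hs.symm
  have hCs : C * Real.exp (-s) ≤ δ * c ^ t :=
    coeff_mul_exp_le (Q := C + 1) (by linarith) (by linarith) (by positivity)
      ((le_max_right _ _).trans_eq hs.symm)
  -- the roughness `u`
  obtain ⟨u, hu⟩ : ∃ u : ℕ, u = max (max u₀ 4) ⌈max (16 * s) (2 * s / η)⌉₊ := ⟨_, rfl⟩
  have hu₀u : u₀ ≤ u := by rw [hu]; exact (le_max_left _ _).trans (le_max_left _ _)
  have hu4 : 4 ≤ u := by rw [hu]; exact (le_max_right _ _).trans (le_max_left _ _)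
  have hureal : max (16 * s) (2 * s / η) ≤ (u : ℝ) :=
    (Nat.le_ceil _).trans (by rw [hu]; exact_mod_cast le_max_right _ _)
  have h16 : 16 * s ≤ (u : ℝ) := (le_max_left _ _).trans hureal
  have h2η : 2 * s / η ≤ (u : ℝ) := (le_max_right _ _).trans hureal
  have hu0 : (0 : ℝ) < u := by exact_mod_cast (show 0 < u by omega)
  have h4s : 4 * s ≤ (u : ℝ) := by linarith
  have hsu8 : 2 * s / u ≤ 1 / 8 := by rw [div_le_iff₀ hu0]; linarith
  have hsuη : 2 * s / u ≤ η := by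
    rw [div_le_iff₀ hu0]; rw [div_le_iff₀ hη] at h2η; linarith
  -- `ε_law`
  obtain ⟨εlaw, hεlaw⟩ : ∃ x : ℝ, x = ε / (2 ^ (t + 2) * ((2 / c) ^ t + 1)) := ⟨_, rfl⟩
  have hεlaw0 : 0 < εlaw := by rw [hεlaw]; positivity
  -- the remaining thresholds and `N₀`
  obtain ⟨Nl, hl⟩ := hCPL t L u ht (by omega) εlaw hεlaw0
  obtain ⟨Nst, hst'⟩ := hst s hs1 u h4s
  obtain ⟨j₁, j₂, -, -, -, -, -, -, c', -, Nm, hm⟩ := hu₀ u hu₀u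
  have h3 : Tendsto (fun N : ℕ => Real.log (Real.log (Real.log (N : ℝ)))) atTop atTop :=
    Real.tendsto_log_atTop.comp (Real.tendsto_log_atTop.comp
      (Real.tendsto_log_atTop.comp tendsto_natCast_atTop_atTop))
  have h1u : (0 : ℝ) < 1 / u := by positivity
  obtain ⟨N₀, hN₀⟩ := Filter.eventually_atTop.mp <| show ∀ᶠ N : ℕ in atTop,
      (Nra ≤ N ∧ Ns ≤ N ∧ Nw ≤ N ∧ Nl ≤ N ∧ Nst ≤ N ∧ Nm ≤ N) ∧
      ((16 : ℝ) ≤ N ∧ 1 ≤ Real.log N) ∧ (2 : ℝ) ≤ (N : ℝ) ^ ((1 : ℝ) / u) ∧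
      (2 * L : ℝ) ≤ (N : ℝ) ^ ((1 : ℝ) / u) ∧ (u : ℝ) ≤ Real.log (Real.log (Real.log N)) ∧
      (C₁ + C₂ + 1) / δ ≤ Real.log N from by
    filter_upwards [eventually_ge_atTop Nra, eventually_ge_atTop Ns, eventually_ge_atTop Nw,
      eventually_ge_atTop Nl, eventually_ge_atTop Nst, eventually_ge_atTop Nm, eventually_basic,
      eventually_rpow_ge 2 h1u, eventually_rpow_ge (2 * L : ℝ) h1u, h3.eventually_ge_atTop (u : ℝ),
      eventually_log_ge ((C₁ + C₂ + 1) / δ)] with N k1 k2 k3 k4 k5 k6 k7 k8 k9 k10 k11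
    exact ⟨⟨k1, k2, k3, k4, k5, k6⟩, k7, k8, k9, k10, k11⟩
  refine ⟨u, by omega, N₀, fun N hN Ψ hΨ hL K hK hKN => ?_⟩
  obtain ⟨⟨hNra, hNs, hNw, hNl, hNst, hNm⟩, ⟨hN16, hℓ1⟩, h2, h2L, hulog, hjunk⟩ := hN₀ N hN
  have hNpos : (0 : ℝ) < N := by linarith
  have hN1 : 1 ≤ N := by exact_mod_cast (show (1 : ℝ) ≤ N by linarith)
  have hℓ0 : 0 < Real.log N := by linarith
  -- the number-theoretic inputs at this scale
  obtain ⟨-, hA1, hAsum⟩ := hra N hNra u hu4 (by rw [one_mul]; exact hulog)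
  have hbal : |∑ j ∈ Finset.Icc 1 u, (-1 : ℝ) ^ j * (roughCell N u j : ℝ)| ≤
      εM * ∑ j ∈ Finset.Icc 1 u, (roughCell N u j : ℝ) := (hm N hNm).2.2
  obtain ⟨θ, hθ0, hθ2, hlaw⟩ := hl N hNl Ψ hΨ hL K hK hKN
  have hlaw' : ∀ j : Fin t → ℕ, (∀ i, 1 ≤ j i ∧ j i ≤ u) →
      |(jointCell Ψ K N u j : ℝ) - walshForm θ j * modelCell Ψ K N u j| ≤
        εlaw * N / Real.log N ^ t := fun j hj => by
    simpa only [jointCell, walshForm, modelCell, roughCell] using hlaw j hj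
  have hW := hWE t Ψ K N u L hΨ hN1 (by omega) hL h2 h2L θ hθ2 _ hlaw'
  -- per-scale notation
  set ℓ := Real.log N
  set M := archFactor Ψ K * singularProduct Ψ
  set Ah := ∑ m ∈ Finset.Icc 1 u, (roughCell N u m : ℝ) / N with hAhdef
  set At := |∑ m ∈ Finset.Icc 1 u, (-1 : ℝ) ^ m * ((roughCell N u m : ℝ) / N)| with hAtdef
  set a := (roughCell N u 1 : ℝ) / N with hadef
  set E := εlaw * N / ℓ ^ t with hEdef
  set J := (C₁ + C₂ + 1) * N / ℓ ^ (t + 1) with hJdef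
  have hM0 : 0 ≤ M := mul_nonneg (archFactor_nonneg Ψ K) (singularProduct_nonneg hΨ)
  have hAh : c * u / ℓ ≤ Ah := by
    rw [hAhdef, ← Finset.sum_div, le_div_iff₀ hNpos]
    calc c * u / ℓ * N = c * u * N / ℓ := by ring
      _ ≤ _ := hAsum
  have ha0 : 0 ≤ a := by positivity
  have ha2 : a ≤ 2 / ℓ := by
    rw [hadef, div_le_iff₀ hNpos]
    calc (roughCell N u 1 : ℝ) ≤ 2 * N / ℓ := hA1
      _ = 2 / ℓ * N := by ring
  have ha1 : a ≤ Ah :=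
    Finset.single_le_sum (f := fun m => (roughCell N u m : ℝ) / N) (fun m _ => by positivity)
      (Finset.mem_Icc.mpr ⟨le_rfl, by omega⟩)
  have hAt : At ≤ εM * Ah := by
    have e1 : (∑ m ∈ Finset.Icc 1 u, (-1 : ℝ) ^ m * ((roughCell N u m : ℝ) / N)) =
        (∑ m ∈ Finset.Icc 1 u, (-1 : ℝ) ^ m * (roughCell N u m : ℝ)) / N := by
      rw [Finset.sum_div]; exact Finset.sum_congr rfl fun m _ => (mul_div_assoc _ _ _).symm
    have e2 : Ah = (∑ m ∈ Finset.Icc 1 u, (roughCell N u m : ℝ)) / N := by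
      rw [hAhdef, Finset.sum_div]
    rw [hAtdef, e1, e2, abs_div, abs_of_pos hNpos, ← mul_div_assoc]
    exact div_le_div_of_nonneg_right hbal hNpos.le
  have hJ0 : 0 ≤ J := by positivity
  have hE0 : 0 ≤ E := by positivity
  -- the per-set bound
  have hkey : ∀ S ∈ (Finset.univ : Finset (Finset (Fin t))).erase ∅,
      |θ S| * (M * a ^ t) ≤ (δ + 2 ^ (t + 1) * εM) * (M * a ^ t) + J + (2 / c) ^ t * E := by
    intro S hS
    have hSne : S ≠ ∅ := Finset.ne_of_mem_erase hS
    obtain ⟨m₁, m₂, hI, hpos, hb⟩ :=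
      hst' N hNst Ψ hΨ hL K hK hKN (tupleSign Ψ S) (tupleSign_eq_one_or Ψ S)
    have hb' : |roughCorrelation Ψ K N u S| ≤ C * Real.exp (-s) * M * ((u : ℝ) / ℓ) ^ t +
        rootClassSums Ψ S m₁ m₂ ⌊(N : ℝ) ^ (2 * s / u)⌋₊ + N / ℓ ^ (t + 1) := hb
    have hP0 : 0 ≤ (N : ℝ) / ℓ ^ (t + 1) := by positivity
    have hcl : rootClassSums Ψ S m₁ m₂ ⌊(N : ℝ) ^ (2 * s / u)⌋₊ ≤ (C₁ + C₂) * N / ℓ ^ (t + 1) := by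
      rcases Nat.lt_or_ge S.card 2 with h1 | h2
      · have hc1 : S.card = 1 := by
          have := (Finset.nonempty_iff_ne_empty.mpr hSne).card_pos; omega
        obtain ⟨i, rfl⟩ := Finset.card_eq_one.mp hc1
        calc rootClassSums Ψ {i} m₁ m₂ ⌊(N : ℝ) ^ (2 * s / u)⌋₊
            ≤ rootClassSums Ψ {i} m₁ m₂ ⌊(N : ℝ) ^ ((1 : ℝ) / 8)⌋₊ :=
              rootClassSums_mono Ψ {i} m₁ m₂ (level_mono hN1 hsu8)
          _ ≤ C₁ * N / ℓ ^ (t + 1) := hsc N hNs Ψ hΨ hL m₁ m₂ hI hpos i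
          _ = C₁ * (N / ℓ ^ (t + 1)) := by ring
          _ ≤ (C₁ + C₂) * (N / ℓ ^ (t + 1)) := mul_le_mul_of_nonneg_right (by linarith) hP0
          _ = (C₁ + C₂) * N / ℓ ^ (t + 1) := by ring
      · calc rootClassSums Ψ S m₁ m₂ ⌊(N : ℝ) ^ (2 * s / u)⌋₊
            ≤ rootClassSums Ψ S m₁ m₂ ⌊(N : ℝ) ^ η⌋₊ :=
              rootClassSums_mono Ψ S m₁ m₂ (level_mono hN1 hsuη)
          _ ≤ C₂ * N / ℓ ^ (t + 1) := hw N hNw Ψ hΨ hL m₁ m₂ hI S h2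
          _ = C₂ * (N / ℓ ^ (t + 1)) := by ring
          _ ≤ (C₁ + C₂) * (N / ℓ ^ (t + 1)) := mul_le_mul_of_nonneg_right (by linarith) hP0
          _ = (C₁ + C₂) * N / ℓ ^ (t + 1) := by ring
    have hES : |roughCorrelation Ψ K N u S| ≤ C * Real.exp (-s) * M * ((u : ℝ) / ℓ) ^ t + J := by
      have : J = (C₁ + C₂) * N / ℓ ^ (t + 1) + N / ℓ ^ (t + 1) := by rw [hJdef]; ring
      rw [this]
      linarith
    exact perSet_bound ht (hW S) hES hM0 hc hAh ha0 ha1 ha2 hℓ1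
      (by exact_mod_cast (show 1 ≤ u by omega)) hAt hJ0 hE0 hδ0.le hCs
  -- summing over `S ≠ ∅` and the prime corner
  have hB0 : 0 ≤ (δ + 2 ^ (t + 1) * εM) * (M * a ^ t) + J + (2 / c) ^ t * E := by positivity
  have hsum := sum_erase_mul_le θ hB0 hkey
  have hlaw1 : |(jointCell Ψ K N u (fun _ => 1) : ℝ) - walshForm θ (fun _ => 1) * (M * a ^ t)| ≤ E := by
    have h := hlaw' (fun _ => 1) (fun _ => ⟨le_rfl, by omega⟩)
    rwa [modelCell_one] at h
  have hfin := corner_cell_le θ hθ0 (by positivity : 0 ≤ M * a ^ t) hlaw1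
  have hJ : J ≤ δ * (N / ℓ ^ t) := by
    have h1 : C₁ + C₂ + 1 ≤ δ * ℓ := by
      have := (div_le_iff₀ hδ0).mp hjunk; linarith
    have h2 : J = (C₁ + C₂ + 1) / ℓ * (N / ℓ ^ t) := by
      rw [hJdef, pow_succ]; field_simp
    rw [h2]
    refine mul_le_mul_of_nonneg_right ?_ (by positivity)
    rwa [div_le_iff₀ hℓ0]
  have hfinal := final_budget (t := t) hε.le hc (by positivity : 0 ≤ M * a ^ t)
    (by positivity : 0 ≤ (N : ℝ) / ℓ ^ t) hδ hεM hεlaw hJ (by rw [hEdef]; ring) hsum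
  show |(jointCell Ψ K N u (fun _ => 1) : ℝ) - M * a ^ t| ≤ ε * (M * a ^ t + N / ℓ ^ t)
  exact hfin.trans hfinal

end Summit.Parity.GeneralizedHardyLittlewood.Cruxes.PrimeCellsRelative.SieveOutToChowla

end
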